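import Mathlib

/-!
# Circulation ledger of an amplitude cascade (the R2 "amplitude rung" dictionary)

HONEST FRAMING: low prior, high value-of-information experiment on Tao's machine paradigm;
NOT a claim that NS blows up.

A pure bookkeeping skeleton (real analysis only, no PDE): a *level ledger* records, per cascade
level `n` (wavenumber `k n = k₀ · lam ^ n`), the circulation `Γ n` delivered intact to that level,
the band sup-velocity `U n`, and the surviving fraction `s n ∈ [0, 1]` of circulation carried from
level `n` to level `n + 1` (the complement `1 - s n` is split off into daughters / threads /
bridges or leaked by viscosity).  The two modelling axioms are

* `split`       : `Γ (n+1) ≤ s n * Γ n`   — no circulation is created (Kelvin; for axisymmetric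
                   Navier–Stokes with swirl this is the maximum principle `sup |r u^θ(t)| ≤ sup |r u^θ(0)|`,
                   Lei–Zhang, Pacific J. Math. 289 (2017), arXiv:1505.02628, eq. (1.4));
* `biot_savart` : `U n ≤ C * k n * Γ n`   — a tube/vortex-dominated band has sup-velocity at most
                   a shape constant times circulation over scale.

Under these, the *level Reynolds number* `levelRe n = U n / (ν k n)` is bounded by
`(C/ν) · Γ 0 · ∏_{i<n} s i` (`levelRe_le_prod`); hence a cascade whose surviving fraction stays
below some `σ < 1` (every splitting cascade of the literature: McKeown et al. 2020 ≈ 0.25 per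
daughter, McKeown et al. 2018 2:1 split, Brenner–Hormoz–Pumir 2016 `Γ_{n+1} = Γ_n b_n/a_n`) has
`levelRe n → 0` (`levelRe_tendsto_zero_of_uniform_split`) and therefore cannot sustain the
Navier–Stokes floor `r = Re_{n+1}/Re_n ≥ 1` of the R2 rung (`no_uniform_split_of_floor`).
The identity `reGain n = gain n / lam` (`reGain_eq`) is the rung's `r = g / λ`.

Intended home (cell placement rule): `Summits/NavierStokesRegularity/FluidComputer/CirculationLedger.lean`,
companion of p1's planned `AmplitudeLedger.lean` (`re_gain_floor`) and p2's `LevelReynoldsFloor`.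
Staged by planner seat pub-fluidc-idea-1 (gen 2; HOME/pub-fluidc-idea-1/lean/,
sha16 f86a07031a946943); filed through the gate verbatim (up to this sentence, the
provenance tag on `Ledger.Admissible` and four one-line docstrings the docstring lint requires)
by pub-fluidc-lit gen 34 at idea-1's ASK (HOME STATUS 2026-08-22T22:51Z).
-/

open Filter Topology

namespace Summit.NavierStokesRegularity.FluidComputer.CirculationLedger

/-- Data of a level ledger of an amplitude cascade. Nothing is asserted by the structure itself. -/
structure Ledger where
  /-- scale ratio per level (`λ` of the R2 rung) -/
  lam : ℝ
  /-- base wavenumber of level `0` -/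
  k₀ : ℝ
  /-- kinematic viscosity -/
  ν : ℝ
  /-- shape constant in the Biot–Savart bound `U n ≤ C * k n * Γ n` -/
  C : ℝ
  /-- circulation delivered intact to level `n` -/
  Γ : ℕ → ℝ
  /-- band sup-velocity at level `n` (`band_umax` of the R2 schema) -/
  U : ℕ → ℝ
  /-- surviving (non-split, non-leaked) circulation fraction of the step `n → n+1` -/
  s : ℕ → ℝ

namespace Ledger

variable (L : Ledger)

/-- Wavenumber of level `n`: `k n = k₀ · lam ^ n`. -/
noncomputable def k (n : ℕ) : ℝ := L.k₀ * L.lam ^ n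

/-- Level Reynolds number `Re_n = U_n / (ν k_n)` (velocity × scale / viscosity, scale = 1/k). -/
noncomputable def levelRe (n : ℕ) : ℝ := L.U n / (L.ν * L.k n)

/-- Amplitude gain of the step `n → n+1`: the rung's `g = U_out / U_in`. -/
noncomputable def gain (n : ℕ) : ℝ := L.U (n + 1) / L.U n

/-- Reynolds gain of the step `n → n+1`: the rung's `r = Re_out / Re_in`. -/
noncomputable def reGain (n : ℕ) : ℝ := L.levelRe (n + 1) / L.levelRe n

/-- The modelling hypotheses of the circulation ledger: a hypothesis bundle, consumed as
`(h : L.Admissible)` by every statement below; nothing in this file asserts it of any ledger.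
[folklore] -/
structure Admissible : Prop where
  one_lt_lam : 1 < L.lam
  k₀_pos : 0 < L.k₀
  ν_pos : 0 < L.ν
  C_pos : 0 < L.C
  Γ_nonneg : ∀ n, 0 ≤ L.Γ n
  U_nonneg : ∀ n, 0 ≤ L.U n
  s_nonneg : ∀ n, 0 ≤ L.s n
  s_le_one : ∀ n, L.s n ≤ 1
  /-- no circulation creation; `1 - s n` is split off or leaked -/
  split : ∀ n, L.Γ (n + 1) ≤ L.s n * L.Γ n
  /-- Biot–Savart shape bound for a vortex-dominated band -/
  biot_savart : ∀ n, L.U n ≤ L.C * L.k n * L.Γ n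

variable {L}

/-- `λ > 0`. -/
theorem lam_pos (h : L.Admissible) : 0 < L.lam := lt_trans zero_lt_one h.one_lt_lam

/-- `k n > 0`. -/
theorem k_pos (h : L.Admissible) (n : ℕ) : 0 < L.k n :=
  mul_pos h.k₀_pos (pow_pos (lam_pos h) n)

/-- `Re_n ≥ 0`. -/
theorem levelRe_nonneg (h : L.Admissible) (n : ℕ) : 0 ≤ L.levelRe n :=
  div_nonneg (h.U_nonneg n) (mul_pos h.ν_pos (k_pos h n)).le

/-- Circulation at level `n` is at most the initial circulation times the product of the
surviving fractions. -/
theorem Γ_le_prod (h : L.Admissible) (n : ℕ) :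
    L.Γ n ≤ L.Γ 0 * ∏ i ∈ Finset.range n, L.s i := by
  induction n with
  | zero => simp
  | succ n ih =>
    calc L.Γ (n + 1) ≤ L.s n * L.Γ n := h.split n
      _ ≤ L.s n * (L.Γ 0 * ∏ i ∈ Finset.range n, L.s i) :=
          mul_le_mul_of_nonneg_left ih (h.s_nonneg n)
      _ = L.Γ 0 * ∏ i ∈ Finset.range (n + 1), L.s i := by
          rw [Finset.prod_range_succ]; ring

/-- The level Reynolds number is controlled by the circulation delivered to that level. -/
theorem levelRe_le_Γ (h : L.Admissible) (n : ℕ) : L.levelRe n ≤ L.C / L.ν * L.Γ n := by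
  unfold levelRe
  have hk := k_pos h n
  have hν := h.ν_pos
  rw [div_le_iff₀ (mul_pos hν hk)]
  calc L.U n ≤ L.C * L.k n * L.Γ n := h.biot_savart n
    _ = L.C / L.ν * L.Γ n * (L.ν * L.k n) := by
        field_simp

/-- **Ledger bound.** `Re_n ≤ (C/ν) · Γ_0 · ∏_{i<n} s_i`. -/
theorem levelRe_le_prod (h : L.Admissible) (n : ℕ) :
    L.levelRe n ≤ L.C / L.ν * L.Γ 0 * ∏ i ∈ Finset.range n, L.s i := by
  calc L.levelRe n ≤ L.C / L.ν * L.Γ n := levelRe_le_Γ h n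
    _ ≤ L.C / L.ν * (L.Γ 0 * ∏ i ∈ Finset.range n, L.s i) :=
        mul_le_mul_of_nonneg_left (Γ_le_prod h n) (div_nonneg h.C_pos.le h.ν_pos.le)
    _ = _ := by ring

/-- `∏_{i<n} s_i ≤ σ ^ n` when every `s_i ≤ σ`. -/
theorem prod_le_pow (h : L.Admissible) {σ : ℝ} (hσ : ∀ n, L.s n ≤ σ) (n : ℕ) :
    ∏ i ∈ Finset.range n, L.s i ≤ σ ^ n := by
  calc ∏ i ∈ Finset.range n, L.s i ≤ ∏ _i ∈ Finset.range n, σ :=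
        Finset.prod_le_prod (fun i _ => h.s_nonneg i) (fun i _ => hσ i)
    _ = σ ^ n := by simp

/-- **A splitting cascade is not sustained.** If the surviving circulation fraction stays below
some `σ < 1` at every step (a level-independent split or leak), the level Reynolds number tends
to zero: the cascade ends in the dissipation range after finitely many effective levels. -/
theorem levelRe_tendsto_zero_of_uniform_split (h : L.Admissible)
    (hs : ∃ σ < 1, ∀ n, L.s n ≤ σ) : Tendsto L.levelRe atTop (𝓝 0) := by
  obtain ⟨σ, hσ1, hσ⟩ := hs
  have hσ0 : 0 ≤ σ := (h.s_nonneg 0).trans (hσ 0)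
  have hK : 0 ≤ L.C / L.ν * L.Γ 0 :=
    mul_nonneg (div_nonneg h.C_pos.le h.ν_pos.le) (h.Γ_nonneg 0)
  have hpow : Tendsto (fun n => L.C / L.ν * L.Γ 0 * σ ^ n) atTop (𝓝 0) := by
    simpa using (tendsto_pow_atTop_nhds_zero_of_lt_one hσ0 hσ1).const_mul (L.C / L.ν * L.Γ 0)
  refine squeeze_zero (fun n => levelRe_nonneg h n) (fun n => ?_) hpow
  exact (levelRe_le_prod h n).trans (mul_le_mul_of_nonneg_left (prod_le_pow h hσ n) hK)

/-- **R2 reading (contrapositive).** A level-Reynolds floor `ρ > 0` held at every level — which is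
what a sustained Reynolds gain `r ≥ 1` delivers — excludes any uniform surviving fraction `σ < 1`:
the circulation must be transported essentially WITHOUT splitting. -/
theorem no_uniform_split_of_floor (h : L.Admissible) {ρ : ℝ} (hρ : 0 < ρ)
    (hfloor : ∀ n, ρ ≤ L.levelRe n) : ¬ ∃ σ < 1, ∀ n, L.s n ≤ σ := by
  intro hs
  have ht := levelRe_tendsto_zero_of_uniform_split h hs
  obtain ⟨n, hn⟩ := (ht.eventually_lt_const hρ).exists
  exact absurd (hfloor n) (not_le.mpr hn)

/-- A sustained floor bounds the surviving-fraction product from below: `∏_{i<n} s_i ≥ ρ ν / (C Γ_0)`. -/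
theorem prod_ge_of_floor (h : L.Admissible) {ρ : ℝ} (hΓ : 0 < L.Γ 0)
    (n : ℕ) (hfloor : ρ ≤ L.levelRe n) :
    ρ * L.ν / (L.C * L.Γ 0) ≤ ∏ i ∈ Finset.range n, L.s i := by
  have hCΓ : 0 < L.C * L.Γ 0 := mul_pos h.C_pos hΓ
  rw [div_le_iff₀ hCΓ]
  have := hfloor.trans (levelRe_le_prod h n)
  have hν := h.ν_pos
  calc ρ * L.ν ≤ L.C / L.ν * L.Γ 0 * (∏ i ∈ Finset.range n, L.s i) * L.ν :=
        mul_le_mul_of_nonneg_right this hν.le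
    _ = (∏ i ∈ Finset.range n, L.s i) * (L.C * L.Γ 0) := by
        field_simp

/-- **Dictionary identity `r = g / λ`.** The Reynolds gain of a step is the amplitude gain divided
by the scale ratio (when the in-level velocity is non-zero). -/
theorem reGain_eq (h : L.Admissible) (n : ℕ) (hU : L.U n ≠ 0) :
    L.reGain n = L.gain n / L.lam := by
  unfold reGain gain levelRe k
  have hν := h.ν_pos.ne'
  have hk0 := h.k₀_pos.ne'
  have hl : L.lam ≠ 0 := (lam_pos h).ne'
  have hln : L.lam ^ n ≠ 0 := pow_ne_zero n hl
  field_simp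
  ring

/-- If moreover the Biot–Savart bound is saturated up to a fixed factor at two consecutive levels
(`U` comparable to `C k Γ`), the Reynolds gain is comparable to the surviving fraction; here the
clean one-sided version: `Re_{n+1} ≤ (C/ν) s_n Γ_n`. -/
theorem levelRe_succ_le (h : L.Admissible) (n : ℕ) :
    L.levelRe (n + 1) ≤ L.C / L.ν * (L.s n * L.Γ n) :=
  (levelRe_le_Γ h (n + 1)).trans
    (mul_le_mul_of_nonneg_left (h.split n) (div_nonneg h.C_pos.le h.ν_pos.le))

end Ledger

end Summit.NavierStokesRegularity.FluidComputer.CirculationLedger
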